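import Summits.NavierStokesRegularity.FunctionalMining.TopEigGapFieldDeriv
import Literature.Analysis.FluidPDE.NSCoriolisTorus
import HarnessLib
/-!
# FunctionalMining — Lemma L-λ, step (iii) auxiliaries: scalar Poincaré on `T³`, smoothness of the
# top projector field on everywhere-simple fields, and the strain–projector identities

Search for candidate a priori estimates; no regularity claim. Cell `pub-nsfunc`, prove seat
(gen 25). Part 1 of 2 of step (iii) of the kernel plan for the dictionary's node `TopEigGapCoerciveTwo η`
(Proposition L-λ(η); part 2 = `TopEigGapCoerciveSimple.lean`, the assembly):

* `four_pi_sq_mul_integral_sq_sub_mean_le` — scalar Poincaré `4π² ∫ (f − ∫f)² ≤ ∫ ∑ₖ (∂ₖf)²` for smooth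
  `f` on `T³` (from the tree's vector form `Torus.integral_norm_sq_le_gradNormSq_of_hasZeroMean`);
* `isSmooth_topProj_entry`, `isSmooth_lamProj_entry` — on fields with `λ₂ < λ₁` everywhere the entries of
  `topProj` and of `M = λ₁ · topProj` are `C^∞` (chart lemma `exists_smooth_topProjector_chart_of_gapForm`);
* `sum_strain_mul_lamProj` (`∑ᵢⱼ Sᵢⱼ Mᵢⱼ = λ₁²`), `integral_strainEntry_eq_zero` (`∫ Sᵢⱼ = 0`),
  `sum_sq_strainEntry_le` (`∑ᵢⱼ Sᵢⱼ² ≤ 36 λ₁²`).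
[ours]
-/

noncomputable section

open Filter Topology Matrix Finset MeasureTheory
open scoped ContDiff

namespace Summit.NavierStokesRegularity.FunctionalMining

open Literature.Analysis Literature.Analysis.FunctionSpaces Literature.Analysis.FunctionSpaces.Torus
  SharpClass.DirectorForm Literature.Analysis.Matrix

namespace TopEig

variable {v : UnitAddTorus (Fin 3) → EuclideanSpace ℝ (Fin 3)}
/-! ## 1. Scalar Poincaré on `T³` -/

/-- **Scalar Poincaré inequality on `T³`**: `4π² ∫ (f − ∫f)² ≤ ∫ ∑ₖ (∂ₖ f)²` for smooth `f`
(the tree's `Torus.integral_norm_sq_le_gradNormSq_of_hasZeroMean` for the field `(f − ∫f) e₀`).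
[folklore] -/
theorem four_pi_sq_mul_integral_sq_sub_mean_le {f : UnitAddTorus (Fin 3) → ℝ} (hf : Torus.IsSmooth f) :
    4 * Real.pi ^ 2 * ∫ x, (f x - ∫ y, f y) ^ 2 ≤ ∫ x, ∑ k, (Torus.partialDeriv k f x) ^ 2 := by
  set c : ℝ := ∫ y, f y with hc
  set b : EuclideanSpace ℝ (Fin 3) := EuclideanSpace.single 0 (1 : ℝ) with hb
  have hbn : ‖b‖ = 1 := by simp [hb]
  set g : UnitAddTorus (Fin 3) → ℝ := fun x => f x - c with hg
  have hgs : Torus.IsSmooth g := hf.sub (isSmooth_const c)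
  have hg0 : ∫ x, g x = 0 := by
    simp only [hg]
    rw [integral_sub hf.integrable (integrable_const c), integral_const]
    simp [hc]
  set w : UnitAddTorus (Fin 3) → EuclideanSpace ℝ (Fin 3) := fun x => g x • b with hw
  have hws : Torus.IsSmooth w := hgs.smul' (isSmooth_const b)
  have hw0 : Torus.HasZeroMean w := by
    show ∫ x, w x = 0
    simp only [hw]
    rw [integral_smul_const, hg0, zero_smul]
  have hP := Literature.Analysis.FluidPDE.Torus.integral_norm_sq_le_gradNormSq_of_hasZeroMean hws hw0
  -- `‖w‖² = g²`
  have hn : ∀ x, ‖w x‖ ^ 2 = (f x - c) ^ 2 := fun x => by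
    simp only [hw, hg, norm_smul, hbn, mul_one, Real.norm_eq_abs, sq_abs]
  -- `∂ₖ w = (∂ₖ f) • b`
  have hdw : ∀ k x, Torus.partialDeriv k w x = Torus.partialDeriv k f x • b := by
    intro k x
    simp only [hw]
    rw [partialDeriv_smul (hgs.isContDiff (by simp)) (isContDiff_const b) k x]
    have h0 : Torus.partialDeriv k (fun _ : UnitAddTorus (Fin 3) => b) x = 0 := by
      simp [Torus.partialDeriv, Torus.lineDeriv]
    rw [h0, smul_zero, zero_add]
    congr 1
    have h1 := congrFun (partialDeriv_sub (hf.isContDiff (by simp)) (isContDiff_const c) k) x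
    have h2 : Torus.partialDeriv k (fun _ : UnitAddTorus (Fin 3) => c) x = 0 := by
      simp [Torus.partialDeriv, Torus.lineDeriv]
    simp only [Pi.sub_apply, h2, sub_zero] at h1
    exact h1
  have hgrad : Torus.gradNormSq w = ∫ x, ∑ k, (Torus.partialDeriv k f x) ^ 2 := by
    unfold Torus.gradNormSq
    refine integral_congr_ae (ae_of_all _ fun x => ?_)
    refine Finset.sum_congr rfl fun k _ => ?_
    rw [hdw, norm_smul, hbn, mul_one, Real.norm_eq_abs, sq_abs]
  simp_rw [hn] at hP
  rw [hgrad] at hP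
  exact hP

/-! ## 2. Smoothness of `topProj` and of `M = λ₁ · topProj` on everywhere-simple fields -/

/-- **The entries of the top projector field are `C^∞` when `λ₁` is simple everywhere.** [ours;
folklore — Kato II-§5] -/
theorem isSmooth_topProj_entry (hv : Torus.IsSmooth v)
    (hsimple : ∀ x : UnitAddTorus (Fin 3), torusStrainMidEig v x < torusStrainTopEig v x) (i j : Fin 3) :
    Torus.IsSmooth (fun y => topProj v y i j) := by
  unfold Torus.IsSmooth
  rw [← liftAt_zero_left]
  refine contDiff_iff_contDiffAt.2 fun w => ?_
  obtain ⟨e, he1, hSe, hg, hgap⟩ := exists_gapForm_of_midEig_lt_topEig (hsimple ((0 : UnitAddTorus (Fin 3)) + proj w))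
  obtain ⟨P, hPs, -, hPev⟩ := exists_smooth_topProjector_chart_of_gapForm hv he1 hSe hg hgap
  have hEq : (fun w' => P w' i j) =ᶠ[𝓝 0]
      liftAt (fun z => topProj v z i j) ((0 : UnitAddTorus (Fin 3)) + proj w) := by
    filter_upwards [hPev] with w' hw'
    have hmem := topVec_mem_topEigSet v (((0 : UnitAddTorus (Fin 3)) + proj w) + proj w')
    rw [flat_torusStrainMatrix] at hmem
    have h := hw' _ hmem
    show P w' i j = topProj v (((0 : UnitAddTorus (Fin 3)) + proj w) + proj w') i j
    rw [topProj, h]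
  exact contDiffAt_liftAt_of_shift ((hPs i j).congr_of_eventuallyEq hEq.symm)

/-- The entries of `M = λ₁ · topProj` are `C^∞` when `λ₁` is simple everywhere. [ours] -/
theorem isSmooth_lamProj_entry (hv : Torus.IsSmooth v)
    (hsimple : ∀ x : UnitAddTorus (Fin 3), torusStrainMidEig v x < torusStrainTopEig v x) (i j : Fin 3) :
    Torus.IsSmooth (fun y => torusStrainTopEig v y * topProj v y i j) := by
  have hgf : ∀ x : UnitAddTorus (Fin 3), ∃ (e : Fin 3 → ℝ) (lam g : ℝ), e ⬝ᵥ e = 1 ∧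
      torusStrainMatrix v x *ᵥ e = lam • e ∧ 0 < g ∧
      ∀ w, w ⬝ᵥ e = 0 → w ⬝ᵥ torusStrainMatrix v x *ᵥ w ≤ (lam - g) * (w ⬝ᵥ w) := fun x => by
    obtain ⟨e, he1, hSe, hg, hgap⟩ := exists_gapForm_of_midEig_lt_topEig (hsimple x)
    exact ⟨e, _, _, he1, hSe, hg, hgap⟩
  have h1 : Torus.IsSmooth (torusStrainTopEig v) := isSmooth_torusStrainTopEig_of_simple hv hgf
  have h2 := isSmooth_topProj_entry hv hsimple i j
  unfold Torus.IsSmooth at h1 h2 ⊢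
  exact h1.mul h2

/-! ## 3. Pointwise identities for the strain against `M` -/

/-- **`∑ᵢⱼ Sᵢⱼ Mᵢⱼ = λ₁²`** (`M = λ₁ u₀⊗u₀`, `S u₀ = λ₁ u₀`, `|u₀| = 1`). [ours, bookkeeping] -/
theorem sum_strain_mul_lamProj (v : UnitAddTorus (Fin 3) → EuclideanSpace ℝ (Fin 3)) (x : UnitAddTorus (Fin 3)) :
    ∑ i, ∑ j, torusStrainMatrix v x i j * (torusStrainTopEig v x * topProj v x i j) =
      torusStrainTopEig v x ^ 2 := by
  have hmul := mulVec_topVec v x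
  have hu := topVec_dotProduct_self v x
  have hq : topVec v x ⬝ᵥ (torusStrainMatrix v x *ᵥ topVec v x) = torusStrainTopEig v x := by
    rw [hmul, dotProduct_smul, hu, smul_eq_mul, mul_one]
  have hexp : topVec v x ⬝ᵥ (torusStrainMatrix v x *ᵥ topVec v x) =
      ∑ i, ∑ j, topVec v x i * (torusStrainMatrix v x i j * topVec v x j) := by
    simp only [dotProduct, Matrix.mulVec, Finset.mul_sum]
  calc ∑ i, ∑ j, torusStrainMatrix v x i j * (torusStrainTopEig v x * topProj v x i j)
      = torusStrainTopEig v x * ∑ i, ∑ j, topVec v x i * (torusStrainMatrix v x i j * topVec v x j) := by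
        rw [Finset.mul_sum]
        refine Finset.sum_congr rfl fun i _ => ?_
        rw [Finset.mul_sum]
        refine Finset.sum_congr rfl fun j _ => ?_
        simp only [topProj, Matrix.vecMulVec_apply]
        ring
    _ = torusStrainTopEig v x ^ 2 := by rw [← hexp, hq]; ring

/-- **`∫ Sᵢⱼ = 0`** for a smooth field (derivatives of periodic functions integrate to zero).
[folklore] -/
theorem integral_strainEntry_eq_zero (hv : Torus.IsSmooth v) (i j : Fin 3) :
    ∫ x, torusStrainMatrix v x i j = 0 := by
  have h1 : ∀ (a b : Fin 3), ∫ x, Torus.partialDeriv a v x b = 0 := by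
    intro a b
    have hsm : Torus.IsSmooth (fun y => v y b) := hv.apply b
    have h := integral_partialDeriv_eq_zero_holds (d := Fin 3) (F := ℝ) hsm a
    rw [← h]
    refine integral_congr_ae (ae_of_all _ fun x => ?_)
    exact (partialDeriv_apply_coord (hv.isContDiff (by simp)) a x b).symm
  have hint : ∀ (a b : Fin 3), Integrable (fun x => Torus.partialDeriv a v x b) volume := fun a b =>
    ((hv.partialDeriv a).apply b).integrable
  simp only [torusStrainMatrix, Matrix.of_apply]
  rw [integral_div, integral_add (hint j i) (hint i j), h1, h1]
  simp

/-- **`∑ᵢⱼ Sᵢⱼ² ≤ 36 λ₁²`** for a smooth divergence-free field (`|S| ≤ 6λ₁`,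
`TopEig.norm_strainFlat_le`). [ours, bookkeeping] -/
theorem sum_sq_strainEntry_le (hv : Torus.IsSmooth v) (hdiv : Torus.IsDivFree v) (x : UnitAddTorus (Fin 3)) :
    ∑ i, ∑ j, (torusStrainMatrix v x i j) ^ 2 ≤ 36 * torusStrainTopEig v x ^ 2 := by
  have hS2 : ∑ i, ∑ j, (torusStrainMatrix v x i j) ^ 2 = ‖StrainL4.strainFlat v x‖ ^ 2 := by
    rw [EuclideanSpace.norm_sq_eq, Fintype.sum_prod_type]
    refine Finset.sum_congr rfl fun i _ => Finset.sum_congr rfl fun j _ => ?_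
    rw [Real.norm_eq_abs, sq_abs, ← flat_torusStrainMatrix]
    rfl
  have h := norm_strainFlat_le hv hdiv x
  rw [lam_strainFlat] at h
  have h0 : 0 ≤ ‖StrainL4.strainFlat v x‖ := norm_nonneg _
  rw [hS2]
  nlinarith

end TopEig

end Summit.NavierStokesRegularity.FunctionalMining

end
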